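import Literature.Computability.Cryptography.GoldreichLevinDecoder
import Literature.Computability.Complexity.HashBricks
import HarnessLib

/-!
# `FP` bricks for the Goldreich–Levin inverter: bitwise xor, masked xor of blocks, first set bit

Machine layer, part 1, for the string model of the Goldreich–Levin decoder
(`GoldreichLevinDecoder.lean`): the three list functions used inside its loops, as clocked loops of
the tree's `FP` bricks (the pattern of `HashBricks.andParityFn`: a round of constant additive
growth iterated `|clock|` times, `iterate_mem_FP`):

* `vxorFn ⟨a, b⟩ = vxor a b` (`= zipWith xor`, truncating; clock `b ↾ |a|`);
* `mxFn ⟨⟨1ⁿ, 1ᵏ⟩, ⟨mask, S⟩⟩ = maskedXor n k mask S` (the rounds are literally `GLDec.mxStep`);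
* `firstTrueFn mask = 1^{firstTrue mask}`.

## References

* S. Arora, B. Barak, *Computational Complexity: A Modern Approach*, CUP 2009, §1.3, §1.4.1.
* O. Goldreich, *Foundations of Cryptography I*, CUP 2001, Thm 2.5.6 (proof).
-/

namespace Literature.Computability.Cryptography

open _root_.Computability Polynomial Complexity Complexity.Brick Complexity.Plumb Complexity.OracleCompose
  Complexity.HashBricks Complexity.PRelSigma GLDec

namespace GLBricks

/-! ### Bitwise xor -/

/-- Round of the xor loop on `⟨a, ⟨b, acc⟩⟩`: consume the heads, append their xor. [folklore] -/
noncomputable def vxBody : List Bool → List Bool :=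
  fanoutFn (List.tail ∘ fstF) (fanoutFn (List.tail ∘ nthF 1)
    (concatFn ∘ fanoutFn (sndPow 1) (xorFn (headBitFn ∘ fstF) (headBitFn ∘ nthF 1))))

/-- One round on a state. [folklore] -/
theorem vxBody_apply (a b acc : List Bool) :
    vxBody (boolPair a (boolPair b acc)) = boolPair a.tail (boolPair b.tail (acc ++ [Bool.xor (a.headD false) (b.headD false)])) := by
  have hx : xorFn (headBitFn ∘ fstF) (headBitFn ∘ nthF 1) (boolPair a (boolPair b acc)) = [Bool.xor (a.headD false) (b.headD false)] :=
    xorFn_apply (by simp) (by simp [nthF])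
  simp only [vxBody, fanoutFn_apply, Function.comp_apply, fstF_boolPair, nthF_succ_boolPair, nthF_zero_boolPair,
    sndPow_succ_boolPair, sndPow_zero_boolPair, concatFn_boolPair, hx]

/-- `vxBody ∈ FP`. [folklore] -/
theorem vxBody_mem_FP : vxBody ∈ FP :=
  fanoutFn_mem_FP (comp_mem_FP tail_mem_FP fstF_mem_FP) (fanoutFn_mem_FP (comp_mem_FP tail_mem_FP (nthF_mem_FP 1))
    (comp_mem_FP concatFn_mem_FP (fanoutFn_mem_FP (sndPow_mem_FP 1)
      (xorFn_mem_FP (comp_mem_FP headBitFn_mem_FP fstF_mem_FP) (comp_mem_FP headBitFn_mem_FP (nthF_mem_FP 1))))))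

/-- Additive growth of the round on every word (`+1` bit, tails do not grow). [folklore] -/
theorem length_vxBody_le (z : List Bool) : (vxBody z).length ≤ z.length + 5 := by
  have h0 := length_fstF_sndF_le z
  have h1 := length_fstF_sndF_le (sndF z)
  have hb := (oneBit_xorFn (oneBit_headBitFn.comp fstF) (oneBit_headBitFn.comp (nthF 1))).length_eq z
  have e1 : nthF 1 z = fstF (sndF z) := rfl
  have e2 : sndPow 1 z = sndF (sndF z) := rfl
  have t1 : (fstF z).tail.length ≤ (fstF z).length := by simp
  have t2 : (fstF (sndF z)).tail.length ≤ (fstF (sndF z)).length := by simp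
  simp only [vxBody, fanoutFn_apply, Function.comp_apply, length_boolPair, concatFn_boolPair, List.length_append, hb, e1, e2] at *
  omega

/-- The xor loop on `⟨clock, state⟩`. [folklore] -/
noncomputable def vxRound : List Bool → List Bool := fanoutFn fstF (vxBody ∘ sndF)

/-- `vxRound ∈ FP`. [folklore] -/
theorem vxRound_mem_FP : vxRound ∈ FP := fanoutFn_mem_FP fstF_mem_FP (comp_mem_FP vxBody_mem_FP sndF_mem_FP)

/-- Additive growth of `vxRound`. [folklore] -/
theorem length_vxRound_le (w : List Bool) : (vxRound w).length ≤ w.length + 7 := by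
  rw [vxRound, fanoutFn_apply, length_boolPair]
  have h1 := length_fstF_sndF_le w
  have h2 := length_vxBody_le (sndF w)
  simp only [Function.comp_apply] at *
  omega

/-- The rounds compute `zipWith xor` on the prefix. [folklore] -/
theorem iterate_vxRound (c : List Bool) : ∀ (j : ℕ) (a b acc : List Bool), j ≤ min a.length b.length →
    vxRound^[j] (boolPair c (boolPair a (boolPair b acc))) =
      boolPair c (boolPair (a.drop j) (boolPair (b.drop j) (acc ++ vxor (a.take j) (b.take j))))
  | 0, a, b, acc, _ => by simp [vxor]
  | j + 1, [], b, acc, h => by simp at h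
  | j + 1, x :: a, [], acc, h => by simp at h
  | j + 1, x :: a, y :: b, acc, h => by
    rw [Function.iterate_succ_apply, vxRound, fanoutFn_apply, fstF_boolPair, Function.comp_apply, sndF_boolPair, vxBody_apply,
      ← vxRound]
    simp only [List.tail_cons, List.headD_cons]
    rw [iterate_vxRound c j a b _ (by simp at h ⊢; omega)]
    simp [vxor, List.append_assoc]

/-- **`vxorFn ⟨a, b⟩ = vxor a b`**: `min |a| |b|` rounds (clock `b ↾ |a|`) from `⟨a, ⟨b, ε⟩⟩`.
[Arora–Barak 2009, §1.3 (loops)] [folklore] -/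
noncomputable def vxorFn : List Bool → List Bool :=
  sndPow 2 ∘ (fun z => vxRound^[(X : Polynomial ℕ).eval (boolUnpair z).1.length] z) ∘
    fanoutFn takeFn (fanoutFn fstF (fanoutFn sndF (fun _ => [])))

/-- **`vxorFn ⟨a, b⟩ = vxor a b`.** [folklore] -/
@[simp] theorem vxorFn_boolPair (a b : List Bool) : vxorFn (boolPair a b) = vxor a b := by
  have hmin : (b.take a.length).length = min a.length b.length := by simp
  have h := iterate_vxRound (b.take a.length) (min a.length b.length) a b [] le_rfl
  simp only [vxorFn, Function.comp_apply, fanoutFn_apply, takeFn_boolPair, fstF_boolPair, sndF_boolPair, boolUnpair_boolPair,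
    eval_X, hmin, h, List.nil_append, sndPow_succ_boolPair, sndPow_zero_boolPair]
  rw [vxor, vxor, ← List.take_zipWith, List.take_of_length_le (by simp [List.length_zipWith])]

/-- **`vxorFn ∈ FP`.** [folklore] -/
theorem vxorFn_mem_FP' : vxorFn ∈ FP :=
  comp_mem_FP (sndPow_mem_FP 2) (comp_mem_FP (iterate_mem_FP vxRound_mem_FP 7 length_vxRound_le X)
    (fanoutFn_mem_FP takeFn_mem_FP (fanoutFn_mem_FP fstF_mem_FP (fanoutFn_mem_FP sndF_mem_FP (const_mem_FP _)))))

/-- `vxorFn` on a pair never lengthens the first component: `|vxor a b| ≤ |a|`. [folklore] -/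
theorem length_vxorFn_boolPair_le (a b : List Bool) : (vxorFn (boolPair a b)).length ≤ a.length := by
  rw [vxorFn_boolPair, length_vxor]; exact min_le_left _ _

/-! ### The masked xor of blocks -/

/-- Round body of the masked xor on `⟨1ⁿ, ⟨mask, ⟨S, acc⟩⟩⟩` — literally `GLDec.mxStep`. [folklore] -/
noncomputable def mxBody : List Bool → List Bool :=
  fanoutFn fstF (fanoutFn (List.tail ∘ nthF 1) (fanoutFn (dropFn ∘ fanoutFn fstF (nthF 2))
    (iteFn (headBitFn ∘ nthF 1) (vxorFn ∘ fanoutFn (sndPow 2) (takeFn ∘ fanoutFn fstF (nthF 2))) (sndPow 2))))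

/-- One round on a state. [folklore] -/
theorem mxBody_apply (n : ℕ) (m S acc : List Bool) :
    mxBody (boolPair (ones n) (boolPair m (boolPair S acc))) =
      boolPair (ones n) (boolPair m.tail (boolPair (S.drop n) (if m.headD false then vxor acc (S.take n) else acc))) := by
  have hc : (headBitFn ∘ nthF 1) (boolPair (ones n) (boolPair m (boolPair S acc))) = [m.headD false] := by simp [nthF]
  simp only [mxBody, fanoutFn_apply, Function.comp_apply, fstF_boolPair, nthF_succ_boolPair, nthF_zero_boolPair, dropFn_boolPair,
    List.length_replicate]
  congr 2
  cases hm : m.headD false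
  · rw [iteFn_apply_false (by rw [hc, hm])]; simp [sndPow]
  · rw [iteFn_apply_true (by rw [hc, hm])]
    simp [sndPow, nthF]

/-- `mxBody ∈ FP`. [folklore] -/
theorem mxBody_mem_FP : mxBody ∈ FP :=
  fanoutFn_mem_FP fstF_mem_FP (fanoutFn_mem_FP (comp_mem_FP tail_mem_FP (nthF_mem_FP 1))
    (fanoutFn_mem_FP (comp_mem_FP dropFn_mem_FP (fanoutFn_mem_FP fstF_mem_FP (nthF_mem_FP 2)))
      (iteFn_mem_FP (comp_mem_FP headBitFn_mem_FP (nthF_mem_FP 1))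
        (comp_mem_FP vxorFn_mem_FP' (fanoutFn_mem_FP (sndPow_mem_FP 2) (comp_mem_FP takeFn_mem_FP (fanoutFn_mem_FP fstF_mem_FP (nthF_mem_FP 2)))))
        (sndPow_mem_FP 2))))

/-- Additive growth of `mxBody` on every word (the xor branch never lengthens the accumulator). [folklore] -/
theorem length_mxBody_le (z : List Bool) : (mxBody z).length ≤ z.length + 8 := by
  have h0 := length_fstF_sndF_le z
  have h1 := length_fstF_sndF_le (sndF z)
  have h2 := length_fstF_sndF_le (sndF (sndF z))
  have e1 : nthF 1 z = fstF (sndF z) := rfl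
  have e2 : nthF 2 z = fstF (sndF (sndF z)) := rfl
  have e3 : sndPow 2 z = sndF (sndF (sndF z)) := rfl
  have t1 : (fstF (sndF z)).tail.length ≤ (fstF (sndF z)).length := by simp
  have hd : (dropFn (fanoutFn fstF (nthF 2) z)).length ≤ (nthF 2 z).length := by
    rw [fanoutFn_apply, dropFn_boolPair]; simp
  have hacc : (iteFn (headBitFn ∘ nthF 1) (vxorFn ∘ fanoutFn (sndPow 2) (takeFn ∘ fanoutFn fstF (nthF 2))) (sndPow 2) z).length ≤
      (sndPow 2 z).length := by
    rw [iteFn_of_oneBit (oneBit_headBitFn.comp (nthF 1))]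
    split_ifs
    · simp only [Function.comp_apply, fanoutFn_apply]; exact length_vxorFn_boolPair_le _ _
    · exact le_rfl
  simp only [mxBody, fanoutFn_apply, Function.comp_apply, length_boolPair, e1, e2, e3] at *
  omega

/-- The masked-xor loop on `⟨clock, state⟩`. [folklore] -/
noncomputable def mxRound : List Bool → List Bool := fanoutFn fstF (mxBody ∘ sndF)

/-- `mxRound ∈ FP`. [folklore] -/
theorem mxRound_mem_FP : mxRound ∈ FP := fanoutFn_mem_FP fstF_mem_FP (comp_mem_FP mxBody_mem_FP sndF_mem_FP)

/-- Additive growth of `mxRound`. [folklore] -/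
theorem length_mxRound_le (w : List Bool) : (mxRound w).length ≤ w.length + 10 := by
  rw [mxRound, fanoutFn_apply, length_boolPair]
  have h1 := length_fstF_sndF_le w
  have h2 := length_mxBody_le (sndF w)
  simp only [Function.comp_apply] at *
  omega

/-- The rounds follow `mxStep`. [folklore] -/
theorem iterate_mxRound (c : List Bool) (n : ℕ) : ∀ (j : ℕ) (q : List Bool × List Bool × List Bool),
    mxRound^[j] (boolPair c (boolPair (ones n) (boolPair q.1 (boolPair q.2.1 q.2.2)))) =
      boolPair c (boolPair (ones n) (boolPair ((mxStep n)^[j] q).1 (boolPair ((mxStep n)^[j] q).2.1 ((mxStep n)^[j] q).2.2)))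
  | 0, q => rfl
  | j + 1, q => by
    rw [Function.iterate_succ_apply, Function.iterate_succ_apply, mxRound, fanoutFn_apply, fstF_boolPair, Function.comp_apply,
      sndF_boolPair, mxBody_apply, ← mxRound]
    exact iterate_mxRound c n j (mxStep n q)

/-- **`mxFn ⟨⟨1ⁿ, 1ᵏ⟩, ⟨mask, S⟩⟩ = maskedXor n k mask S`**: `k` rounds from `⟨1ᵏ, ⟨1ⁿ, ⟨mask, ⟨S, 0ⁿ⟩⟩⟩⟩`.
[Arora–Barak 2009, Thm 9.12 (proof: `r_T = Σ_{t∈T} sᵗ`)] [folklore] -/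
noncomputable def mxFn : List Bool → List Bool :=
  sndPow 3 ∘ (fun z => mxRound^[(X : Polynomial ℕ).eval (boolUnpair z).1.length] z) ∘
    fanoutFn (sndF ∘ fstF) (fanoutFn (fstF ∘ fstF) (fanoutFn (fstF ∘ sndF) (fanoutFn (sndF ∘ sndF) (Kannan.zerosFn ∘ fstF ∘ fstF))))

/-- **`mxFn ⟨⟨1ⁿ, 1ᵏ⟩, ⟨mask, S⟩⟩ = maskedXor n k mask S`.** [folklore] -/
@[simp] theorem mxFn_boolPair (n k : ℕ) (mask S : List Bool) :
    mxFn (boolPair (boolPair (ones n) (ones k)) (boolPair mask S)) = maskedXor n k mask S := by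
  have h := iterate_mxRound (ones k) n k (mask, S, List.replicate n false)
  simp only [mxFn, Function.comp_apply, fanoutFn_apply, fstF_boolPair, sndF_boolPair, boolUnpair_boolPair, eval_X,
    Kannan.zerosFn_apply, List.length_replicate] at h ⊢
  rw [h]
  simp [sndPow, maskedXor]

/-- **`mxFn ∈ FP`.** [folklore] -/
theorem mxFn_mem_FP : mxFn ∈ FP :=
  comp_mem_FP (sndPow_mem_FP 3) (comp_mem_FP (iterate_mem_FP mxRound_mem_FP 10 length_mxRound_le X)
    (fanoutFn_mem_FP (comp_mem_FP sndF_mem_FP fstF_mem_FP) (fanoutFn_mem_FP (comp_mem_FP fstF_mem_FP fstF_mem_FP)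
      (fanoutFn_mem_FP (comp_mem_FP fstF_mem_FP sndF_mem_FP) (fanoutFn_mem_FP (comp_mem_FP sndF_mem_FP sndF_mem_FP)
        (comp_mem_FP Kannan.zerosFn_mem_FP (comp_mem_FP fstF_mem_FP fstF_mem_FP)))))))

/-! ### The first set bit -/

/-- The model of the scan: count leading `false`s until the first `true`. [folklore] -/
def ftModel : List Bool → ℕ → Bool → ℕ × Bool
  | [], cnt, found => (cnt, found)
  | b :: l, cnt, found => ftModel l (if found || b then cnt else cnt + 1) (found || b)

/-- Once found, the count is frozen. [folklore] -/
theorem ftModel_true : ∀ (l : List Bool) (cnt : ℕ), ftModel l cnt true = (cnt, true)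
  | [], cnt => rfl
  | b :: l, cnt => by simp [ftModel, ftModel_true l]

/-- The scan counts up to the first `true`. [folklore] -/
theorem ftModel_false : ∀ (l : List Bool) (cnt : ℕ), (ftModel l cnt false).1 = cnt + firstTrue l
  | [], cnt => rfl
  | b :: l, cnt => by
    cases b
    · simp only [ftModel, Bool.or_false, Bool.false_eq_true, ite_false, firstTrue]
      rw [ftModel_false l]; omega
    · simp [ftModel, ftModel_true, firstTrue]

/-- Prefix scans compose. [folklore] -/
theorem ftModel_append : ∀ (l l' : List Bool) (cnt : ℕ) (found : Bool),
    ftModel (l ++ l') cnt found = ftModel l' (ftModel l cnt found).1 (ftModel l cnt found).2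
  | [], l', cnt, found => rfl
  | b :: l, l', cnt, found => by simp only [List.cons_append, ftModel]; exact ftModel_append l l' _ _

/-- The new `found` flag `[found ∨ head rem]` on `⟨rem, ⟨cnt, found⟩⟩`. [folklore] -/
noncomputable def ftFound : List Bool → List Bool := iteFn (headBitFn ∘ sndPow 1) (fun _ => [true]) (headBitFn ∘ fstF)

/-- Round body of the scan on `⟨rem, ⟨cnt, found⟩⟩`. [folklore] -/
noncomputable def ftBody : List Bool → List Bool :=
  fanoutFn (List.tail ∘ fstF) (fanoutFn (iteFn ftFound (nthF 1) (List.cons true ∘ nthF 1)) ftFound)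

/-- Value of the flag. [folklore] -/
theorem ftFound_apply (rem : List Bool) (cnt : ℕ) (found : Bool) :
    ftFound (boolPair rem (boolPair (ones cnt) [found])) = [found || rem.headD false] := by
  unfold ftFound
  cases found
  · rw [iteFn_apply_false (by simp [sndPow])]; simp
  · rw [iteFn_apply_true (by simp [sndPow])]; simp

/-- One round on a state. [folklore] -/
theorem ftBody_apply (rem : List Bool) (cnt : ℕ) (found : Bool) :
    ftBody (boolPair rem (boolPair (ones cnt) [found])) =
      boolPair rem.tail (boolPair (ones (if found || rem.headD false then cnt else cnt + 1)) [found || rem.headD false]) := by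
  have hf := ftFound_apply rem cnt found
  simp only [ftBody, fanoutFn_apply, Function.comp_apply, fstF_boolPair, hf]
  congr 2
  cases h : (found || rem.headD false)
  · rw [iteFn_apply_false (by rw [hf, h]), if_neg (by simp)]
    simp [nthF, Com.ones_succ]
  · rw [iteFn_apply_true (by rw [hf, h]), if_pos rfl]
    simp [nthF]

/-- `ftFound` is one-bit. [folklore] -/
theorem oneBit_ftFound : OneBit ftFound :=
  (oneBit_headBitFn.comp (sndPow 1)).ite (fun _ => ⟨true, rfl⟩) (oneBit_headBitFn.comp fstF)

/-- `ftBody ∈ FP`. [folklore] -/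
theorem ftBody_mem_FP : ftBody ∈ FP := by
  have hF : ftFound ∈ FP := iteFn_mem_FP (comp_mem_FP headBitFn_mem_FP (sndPow_mem_FP 1)) (const_mem_FP _)
    (comp_mem_FP headBitFn_mem_FP fstF_mem_FP)
  exact fanoutFn_mem_FP (comp_mem_FP tail_mem_FP fstF_mem_FP)
    (fanoutFn_mem_FP (iteFn_mem_FP hF (nthF_mem_FP 1) (comp_mem_FP (cons_mem_FP true) (nthF_mem_FP 1))) hF)

/-- Additive growth of `ftBody`. [folklore] -/
theorem length_ftBody_le (z : List Bool) : (ftBody z).length ≤ z.length + 7 := by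
  have h0 := length_fstF_sndF_le z
  have h1 := length_fstF_sndF_le (sndF z)
  have e1 : nthF 1 z = fstF (sndF z) := rfl
  have t1 : (fstF z).tail.length ≤ (fstF z).length := by simp
  have hf := oneBit_ftFound.length_eq z
  have hc : (iteFn ftFound (nthF 1) (List.cons true ∘ nthF 1) z).length ≤ (nthF 1 z).length + 1 := by
    rw [iteFn_of_oneBit oneBit_ftFound]; split_ifs <;> simp
  simp only [ftBody, fanoutFn_apply, Function.comp_apply, length_boolPair, e1] at *
  omega

/-- The scan loop on `⟨clock, state⟩`. [folklore] -/
noncomputable def ftRound : List Bool → List Bool := fanoutFn fstF (ftBody ∘ sndF)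

/-- `ftRound ∈ FP`. [folklore] -/
theorem ftRound_mem_FP : ftRound ∈ FP := fanoutFn_mem_FP fstF_mem_FP (comp_mem_FP ftBody_mem_FP sndF_mem_FP)

/-- Additive growth of `ftRound`. [folklore] -/
theorem length_ftRound_le (w : List Bool) : (ftRound w).length ≤ w.length + 9 := by
  rw [ftRound, fanoutFn_apply, length_boolPair]
  have h1 := length_fstF_sndF_le w
  have h2 := length_ftBody_le (sndF w)
  simp only [Function.comp_apply] at *
  omega

/-- The rounds follow the model on the prefix. [folklore] -/
theorem iterate_ftRound (c : List Bool) : ∀ (j : ℕ) (rem : List Bool) (cnt : ℕ) (found : Bool), j ≤ rem.length →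
    ftRound^[j] (boolPair c (boolPair rem (boolPair (ones cnt) [found]))) =
      boolPair c (boolPair (rem.drop j) (boolPair (ones (ftModel (rem.take j) cnt found).1) [(ftModel (rem.take j) cnt found).2]))
  | 0, rem, cnt, found, _ => by simp [ftModel]
  | j + 1, [], cnt, found, h => by simp at h
  | j + 1, b :: rem, cnt, found, h => by
    rw [Function.iterate_succ_apply, ftRound, fanoutFn_apply, fstF_boolPair, Function.comp_apply, sndF_boolPair, ftBody_apply,
      ← ftRound]
    simp only [List.tail_cons, List.headD_cons]
    rw [iterate_ftRound c j rem _ _ (by simpa using h)]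
    simp [ftModel]

/-- **`firstTrueFn mask = 1^{firstTrue mask}`**: `|mask|` rounds from `⟨mask, ⟨mask, ⟨ε, [0]⟩⟩⟩`. [folklore] -/
noncomputable def firstTrueFn : List Bool → List Bool :=
  nthF 2 ∘ (fun z => ftRound^[(X : Polynomial ℕ).eval (boolUnpair z).1.length] z) ∘
    fanoutFn id (fanoutFn id (fanoutFn (fun _ => []) (fun _ => [false])))

/-- **`firstTrueFn mask = 1^{firstTrue mask}`.** [folklore] -/
@[simp] theorem firstTrueFn_apply (mask : List Bool) : firstTrueFn mask = ones (firstTrue mask) := by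
  have h := iterate_ftRound mask mask.length mask 0 false le_rfl
  simp only [List.drop_length, List.take_length, ftModel_false, zero_add] at h
  simp only [firstTrueFn, Function.comp_apply, fanoutFn_apply, id, boolUnpair_boolPair, eval_X]
  rw [show boolPair mask (boolPair mask (boolPair [] [false])) = boolPair mask (boolPair mask (boolPair (ones 0) [false])) from rfl, h]
  simp [nthF]

/-- **`firstTrueFn ∈ FP`.** [folklore] -/
theorem firstTrueFn_mem_FP : firstTrueFn ∈ FP :=
  comp_mem_FP (nthF_mem_FP 2) (comp_mem_FP (iterate_mem_FP ftRound_mem_FP 9 length_ftRound_le X)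
    (fanoutFn_mem_FP OracleCompose.id_mem_FP (fanoutFn_mem_FP OracleCompose.id_mem_FP (fanoutFn_mem_FP (const_mem_FP _) (const_mem_FP _)))))

end GLBricks

end Literature.Computability.Cryptography
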